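import Literature.Computability.AlgebraicComplexity.LMR13ImmanantFourTermRelations
import HarnessLib

/-!
# LMR 2013 Thm. 3.1.1, the isotypic step at weight zero: `T̂_{[det_n]}𝒟ual ∩ ⟨x_ρ⟩ ⊆ 𝔤𝔩(W)·det_n`

[topic Computability/AlgebraicComplexity]

Landsberg–Manivel–Ressayre 2013 (Comment. Math. Helv. 88, §3.4, pp. 478–480; arXiv:1004.4802
`p0007.txt:L41`–`p0008.txt:L43`) deduce the tangent-space clause of Thm. 3.1.1,
`T̂_{[det_n]}𝒟ual_{2n−2,n,n²} = 𝔤𝔩(W)·det_n`, from Prop. 3.4.2 (`P_n = {1ⁿ, 21^{n−2}}`) and the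
multiplicity-free `GL(E)×GL(F)`-decomposition `Sⁿ(E⊗F) = ⊕_π S_πE⊗S_πF` (Cauchy), which the tree does
not have. This file proves the WEIGHT-ZERO part of the inclusion `T̂ ⊆ 𝔤𝔩(W)·det_n` by an elementary
route that uses neither characters nor the decomposition:

* `permSum c = Σ_ρ c(ρ) · ∏ᵢ x_{iρ(i)}` — the forms spanned by the `n!` permutation monomials (the
  `((1ⁿ),(1ⁿ))`-weight space of `Sⁿ(E⊗F)^*`; `immanant λ = permSum χ_λ`).
* `permSum_fourTerm_of_mem_lmrZariskiTangent` — val-lit-p7 g3's sparse-point engine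
  (`LMR13ImmanantFourTermRelations.lean`: the corank-one point `w_{σ,k,m}`, the kernel vector
  `X_{σ,a,c}`, the constant `c_{X,w} = −2` of LMR Lemma 3.3.2) run with ARBITRARY coefficients:
  `permSum c ∈ T̂ ⟹ c(σ) + c(σ(ac)) + c(σ(km)) + c(σ(ac)(km)) = 0` for pairwise distinct `a,c,k,m`.
* `exists_matrix_of_fourTermDiff` — a COCYCLE LEMMA on `𝔖_n` (`n ≥ 4`, pure combinatorics): a function
  with all four-term differences zero is `ρ ↦ Σ_a C_{a,ρ(a)} + κ` (applied to `sgn·c`).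
* `permSum_mem_glTangent_detPoly_of_mem_lmrZariskiTangent` — hence (`n ≥ 4`)
  `permSum c = Σ_{a,b} C_{ab} · x_{ab}∂_{ab}det_n + κ·det_n ∈ 𝔤𝔩(W)·det_n`; at `n = 3` (no four distinct
  indices) the same conclusion from `per₃ ∉ T̂` (val-lit-p8's certificate / `perPoly_not_mem_lmrZariskiTangent`)
  and `x_σ − x_{σ(km)} ∈ 𝔤𝔩(W)·det₃`.

Theorem-only apart from the abbreviations `permSum`, `pairRep`, `pairFun`; 0 named facts. Cell val-lit (D-0074), seat
val-lit-p7 g4, row LMR13-A. Honest framing: a step in the proof of the smoothness statement LMR13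
Thm. 3.1.1 about the dual scheme of `det_n`; VP ≠ VNP is NOT proved and nothing here is progress on it.

## References

* [LandsbergManivelRessayre2013] J. M. Landsberg, L. Manivel, N. Ressayre, *Hypersurfaces with
  degenerate duals and the geometric complexity theory program*, Comment. Math. Helv. 88 (2013)
  469–484, §3.4 (Lemma 3.4.1, Prop. 3.4.2, proof of Thm. 3.1.1), pp. 478–480.
-/

noncomputable section

open MvPolynomial Matrix

namespace Literature.Computability.AlgebraicComplexity

open _root_.Literature.NumberTheory.DiophantineGeometry _root_.Literature.RepresentationTheory.FiniteGroups

variable {n : ℕ}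

/-! ### The weight-zero forms `permSum c` and their Hessian quadratic form -/

section PermSum

/-- The form `Σ_ρ c(ρ) · ∏ᵢ x_{iρ(i)}` with coefficient vector `c : 𝔖_n → ℂ` on the permutation
monomials — the general element of the `((1ⁿ),(1ⁿ))`-weight space of `Sⁿ(E⊗F)^*`, of which the
immanants `IM_λ = permSum χ_λ` of LMR 2013 §3.4 (p. 478) are the class-function instances.
[cite: LandsbergManivelRessayre2013, §3.4 (p. 478)] -/
def permSum (c : Equiv.Perm (Fin n) → ℂ) : MvPolynomial (Fin n × Fin n) ℂ :=
  ∑ ρ : Equiv.Perm (Fin n), c ρ • ∏ i : Fin n, X (i, ρ i)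

/-- `IM_λ = permSum χ_λ`. [cite: LandsbergManivelRessayre2013, §3.4 (p. 478)] -/
theorem immanant_eq_permSum (lam : Nat.Partition n) :
    immanant lam = permSum (spechtCharacter ℂ lam) := rfl

/-- `det_n = permSum sgn`. [cite: LandsbergManivelRessayre2013, §3.4 (p. 478)] -/
theorem detPoly_eq_permSum :
    detPoly (Fin n) ℂ = permSum fun ρ => ((Equiv.Perm.sign ρ : ℤ) : ℂ) :=
  detPoly_eq_sum_sign_smul_prod

/-- `per_n = permSum 1`. [cite: LandsbergManivelRessayre2013, §3.4 (p. 478)] -/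
theorem perPoly_eq_permSum : perPoly (Fin n) ℂ = permSum fun _ => (1 : ℂ) := by
  rw [perPoly_eq_sum_prod, permSum]
  simp only [one_smul]

/-- `permSum` is linear: `permSum (a • c + b • c') = a • permSum c + b • permSum c'`. [folklore] -/
private theorem permSum_add_smul (c c' : Equiv.Perm (Fin n) → ℂ) (a b : ℂ) :
    permSum (fun ρ => a * c ρ + b * c' ρ) = a • permSum c + b • permSum c' := by
  simp only [permSum, add_smul, Finset.sum_add_distrib, Finset.smul_sum, smul_smul]

/-- `permSum c` is homogeneous of degree `n` (an element of `SⁿW^*`). [cite: LandsbergManivelRessayre2013, §3.4 (p. 478)] -/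
theorem permSum_isHomogeneous (c : Equiv.Perm (Fin n) → ℂ) : (permSum c).IsHomogeneous n := by
  classical
  refine IsHomogeneous.sum _ _ _ fun ρ _ => ?_
  rw [smul_eq_C_mul]
  have h := IsHomogeneous.prod (Finset.univ : Finset (Fin n))
    (fun i => (X (i, ρ i) : MvPolynomial (Fin n × Fin n) ℂ)) (fun _ => 1) fun i _ => isHomogeneous_X ℂ _
  simp only [Finset.sum_const, Finset.card_univ, Fintype.card_fin, smul_eq_mul, mul_one] at h
  simpa using (isHomogeneous_C _ (c ρ)).mul h

/-- Second partial derivatives of `permSum c`: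
`∂_{cd} ∂_{ab} permSum c = Σ_{ρ : ρ a = b, ρ c = d, a ≠ c} c(ρ) ∏_{i ≠ a,c} x_{iρ(i)}`.
[cite: LandsbergManivelRessayre2013, §3.4 (p. 479)] -/
theorem pderiv_pderiv_permSum (cf : Equiv.Perm (Fin n) → ℂ) (a b c d : Fin n) :
    pderiv (c, d) (pderiv (a, b) (permSum cf)) = ∑ σ : Equiv.Perm (Fin n),
      if σ a = b ∧ c ≠ a ∧ σ c = d then
        C (cf σ) * ∏ i ∈ (Finset.univ.erase a).erase c, X (i, σ i)
      else 0 := by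
  rw [permSum, map_sum, map_sum]
  refine Finset.sum_congr rfl fun σ _ => ?_
  rw [smul_eq_C_mul, pderiv_C_mul, pderiv_C_mul, pderiv_pderiv_prod_X_perm_row]
  split_ifs <;> simp

/-- The Hessian matrix of `permSum c` at a point `w`, entry by entry.
[cite: LandsbergManivelRessayre2013, §3.4 (p. 479)] -/
theorem hessianMatrix_permSum_apply (cf : Equiv.Perm (Fin n) → ℂ) (w : Fin n × Fin n → ℂ)
    (a b c d : Fin n) :
    hessianMatrix (permSum cf) w (c, d) (a, b) = ∑ σ : Equiv.Perm (Fin n),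
      if σ a = b ∧ c ≠ a ∧ σ c = d then
        cf σ * ∏ i ∈ (Finset.univ.erase a).erase c, w (i, σ i)
      else 0 := by
  rw [hessianMatrix_apply, pderiv_pderiv_permSum, map_sum]
  refine Finset.sum_congr rfl fun σ _ => ?_
  split_ifs
  · simp [map_prod]
  · simp

/-- **The Hessian quadratic form of `permSum c`** (ordered pairs `a ≠ c`):
`Xᵀ Hess(permSum c)(w) X = Σ_σ c(σ) Σ_{a ≠ c} X_{aσ(a)} X_{cσ(c)} ∏_{i ≠ a,c} w_{iσ(i)}` — the
computation `H_{IM_λ,w}(X)` of LMR §3.4 (arXiv `p0007.txt:L63–74`) with arbitrary coefficients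
(val-lit-t10's `dotProduct_hessianMatrix_immanant_mulVec`, verbatim).
[cite: LandsbergManivelRessayre2013, §3.4 (p. 479)] -/
theorem dotProduct_hessianMatrix_permSum_mulVec (cf : Equiv.Perm (Fin n) → ℂ)
    (w X : Fin n × Fin n → ℂ) :
    X ⬝ᵥ (hessianMatrix (permSum cf) w *ᵥ X) = ∑ σ : Equiv.Perm (Fin n),
      cf σ * ∑ a, ∑ c ∈ Finset.univ.erase a,
        X (a, σ a) * X (c, σ c) * ∏ i ∈ (Finset.univ.erase a).erase c, w (i, σ i) := by
  have hexp : X ⬝ᵥ (hessianMatrix (permSum cf) w *ᵥ X) =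
      ∑ p : Fin n × Fin n, ∑ q : Fin n × Fin n, ∑ σ : Equiv.Perm (Fin n),
        X p * ((if σ q.1 = q.2 ∧ p.1 ≠ q.1 ∧ σ p.1 = p.2 then
          cf σ * ∏ i ∈ (Finset.univ.erase q.1).erase p.1, w (i, σ i)
          else 0) * X q) := by
    simp only [dotProduct, Matrix.mulVec, Finset.mul_sum]
    refine Finset.sum_congr rfl fun p _ => Finset.sum_congr rfl fun q _ => ?_
    obtain ⟨c, d⟩ := p
    obtain ⟨a, b⟩ := q
    rw [hessianMatrix_permSum_apply, Finset.sum_mul, Finset.mul_sum]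
  rw [hexp, Finset.sum_congr rfl fun p _ => Finset.sum_comm, Finset.sum_comm]
  refine Finset.sum_congr rfl fun σ _ => ?_
  have hcol : ∀ c : Fin n, (∑ y, ∑ q : Fin n × Fin n, X (c, y) *
      ((if σ q.1 = q.2 ∧ (c, y).1 ≠ q.1 ∧ σ (c, y).1 = (c, y).2 then
        cf σ * ∏ i ∈ (Finset.univ.erase q.1).erase (c, y).1, w (i, σ i)
        else 0) * X q)) =
      ∑ a, if c ≠ a then cf σ * (X (a, σ a) * X (c, σ c) *
        ∏ i ∈ (Finset.univ.erase a).erase c, w (i, σ i)) else 0 := by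
    intro c
    rw [Finset.sum_eq_single (σ c) (fun y _ hy => Finset.sum_eq_zero fun q _ => by
        rw [if_neg (fun h => hy h.2.2.symm), zero_mul, mul_zero])
      (fun h => absurd (Finset.mem_univ _) h)]
    rw [Fintype.sum_prod_type]
    refine Finset.sum_congr rfl fun a _ => ?_
    rw [Finset.sum_eq_single (σ a) (fun b _ hb => by
        rw [if_neg (fun h => hb h.1.symm), zero_mul, mul_zero])
      (fun h => absurd (Finset.mem_univ _) h)]
    dsimp only
    by_cases hca : c ≠ a
    · rw [if_pos ⟨rfl, hca, rfl⟩, if_pos hca]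
      ring
    · rw [if_neg (fun h => hca h.2.1), if_neg hca, zero_mul, mul_zero]
  rw [Fintype.sum_prod_type]
  simp_rw [hcol]
  rw [Finset.sum_comm, Finset.mul_sum]
  refine Finset.sum_congr rfl fun a _ => ?_
  rw [Finset.mul_sum, ← Finset.sum_filter, Finset.filter_ne']

end PermSum

/-! ### The four-term relations for an arbitrary weight-zero tangent vector -/

section FourTerm

variable (σ : Equiv.Perm (Fin n)) {a c k m : Fin n}

/-- **`(permSum c)(w_{σ,k,m}) = c(σ) + c(σ·(k m))`** (val-lit-p7 g3's `eval_fourTermW_immanant` with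
arbitrary coefficients). [cite: LandsbergManivelRessayre2013, Lemma 3.4.1 (p. 479)] -/
theorem eval_fourTermW_permSum (hkm : k ≠ m) (cf : Equiv.Perm (Fin n) → ℂ) :
    eval (fun p : Fin n × Fin n => fourTermW σ k m p.1 p.2) (permSum cf) =
      cf σ + cf (σ * Equiv.swap k m) := by
  classical
  rw [permSum, map_sum]
  simp_rw [smul_eval, map_prod, eval_X]
  simp_rw [prod_fourTermW_apply_perm σ hkm, mul_boole]
  simp only [Finset.mem_univ, forall_true_left]
  exact sum_ite_forall_compat σ hkm _

/-- **`Xᵀ·Hess(permSum c)(w_{σ,k,m})·X = 2·(c(σ(ac)) + c(σ(ac)(km)))`** for `X = X_{σ,a,c}`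
(val-lit-p7 g3's `dotProduct_hessianMatrix_immanant_fourTerm` with arbitrary coefficients).
[cite: LandsbergManivelRessayre2013, Lemma 3.4.1 (p. 479)] -/
theorem dotProduct_hessianMatrix_permSum_fourTerm (hac : a ≠ c) (hak : a ≠ k) (ham : a ≠ m)
    (hck : c ≠ k) (hcm : c ≠ m) (hkm : k ≠ m) (cf : Equiv.Perm (Fin n) → ℂ) :
    (fun p : Fin n × Fin n => fourTermX σ a c k m p.1 p.2) ⬝ᵥ
        (hessianMatrix (permSum cf) (fun p => fourTermW σ k m p.1 p.2) *ᵥ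
          fun p => fourTermX σ a c k m p.1 p.2) =
      2 * (cf (σ * Equiv.swap a c) + cf (σ * Equiv.swap a c * Equiv.swap k m)) := by
  classical
  rw [dotProduct_hessianMatrix_permSum_mulVec]
  have hX : ∀ i j, fourTermX σ a c k m i j = if (i = a ∧ σ c = j) ∨ (i = c ∧ σ a = j) then 1 else 0 :=
    fourTermX_apply σ hac hak ham hck hcm hkm
  have hinner : ∀ ρ : Equiv.Perm (Fin n),
      (∑ a', ∑ c' ∈ Finset.univ.erase a', fourTermX σ a c k m a' (ρ a') *
        fourTermX σ a c k m c' (ρ c') * ∏ i ∈ (Finset.univ.erase a').erase c',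
          fourTermW σ k m i (ρ i)) =
      2 * if (σ c = ρ a ∧ σ a = ρ c ∧ ∀ i ∈ (Finset.univ.erase a).erase c,
          ((i = k ∨ i = m) → (σ k = ρ i ∨ σ m = ρ i)) ∧ (¬(i = k ∨ i = m) → σ i = ρ i))
        then 1 else 0 := by
    intro ρ
    have hzero : ∀ a', a' ≠ a → a' ≠ c → fourTermX σ a c k m a' (ρ a') = 0 := by
      intro a' h1 h2
      rw [hX, if_neg (by tauto)]
    have hXa : fourTermX σ a c k m a (ρ a) = if σ c = ρ a then 1 else 0 := by
      rw [hX]; by_cases h : σ c = ρ a <;> simp [h, hac]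
    have hXc : fourTermX σ a c k m c (ρ c) = if σ a = ρ c then 1 else 0 := by
      rw [hX]; by_cases h : σ a = ρ c <;> simp [h, Ne.symm hac]
    rw [Finset.sum_eq_add_of_mem a c (Finset.mem_univ _) (Finset.mem_univ _) hac
      (fun a' _ ha' => Finset.sum_eq_zero fun c' _ => by
        rw [hzero a' ha'.1 ha'.2, zero_mul, zero_mul]),
      Finset.sum_eq_single_of_mem c (Finset.mem_erase.mpr ⟨hac.symm, Finset.mem_univ _⟩)
        (fun c' hc' hc'c => by
          rw [hzero c' (Finset.mem_erase.mp hc').1 hc'c, mul_zero, zero_mul]),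
      Finset.sum_eq_single_of_mem a (Finset.mem_erase.mpr ⟨hac, Finset.mem_univ _⟩)
        (fun a' ha' ha'a => by
          rw [hzero a' ha'a (Finset.mem_erase.mp ha').1, mul_zero, zero_mul]),
      hXa, hXc, Finset.erase_right_comm (a := c), prod_fourTermW_apply_perm σ hkm]
    simp only [boole_mul, ite_and]
    by_cases h1 : σ c = ρ a <;> by_cases h2 : σ a = ρ c <;> simp [h1, h2]
    all_goals (try (split_ifs <;> norm_num))
  simp_rw [hinner, swapped_compat_iff σ hak ham hck hcm hkm]
  have hne : σ * Equiv.swap a c ≠ σ * Equiv.swap a c * Equiv.swap k m := by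
    intro h
    have := congrArg (· k) h
    simp only [Equiv.Perm.mul_apply, Equiv.swap_apply_left] at this
    exact hkm ((σ * Equiv.swap a c).injective (by simpa [Equiv.Perm.mul_apply] using this))
  simp_rw [mul_ite, mul_one, mul_zero]
  have hsplit : ∀ ρ : Equiv.Perm (Fin n),
      (if ρ = σ * Equiv.swap a c ∨ ρ = σ * Equiv.swap a c * Equiv.swap k m then cf ρ * 2 else 0) =
      (if ρ = σ * Equiv.swap a c then cf ρ * 2 else 0) +
        (if ρ = σ * Equiv.swap a c * Equiv.swap k m then cf ρ * 2 else 0) := by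
    intro ρ
    by_cases h1 : ρ = σ * Equiv.swap a c
    · rw [if_pos (Or.inl h1), if_pos h1, if_neg (fun h2 => hne (h1.symm.trans h2)), add_zero]
    · by_cases h2 : ρ = σ * Equiv.swap a c * Equiv.swap k m
      · rw [if_pos (Or.inr h2), if_neg h1, if_pos h2, zero_add]
      · rw [if_neg (not_or.mpr ⟨h1, h2⟩), if_neg h1, if_neg h2, add_zero]
  simp_rw [hsplit]
  rw [Finset.sum_add_distrib, Finset.sum_ite_eq' Finset.univ (σ * Equiv.swap a c),
    Finset.sum_ite_eq' Finset.univ, if_pos (Finset.mem_univ _), if_pos (Finset.mem_univ _)]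
  ring

/-- **The four-term relations for an arbitrary weight-zero Zariski tangent vector** (LMR Lemma 3.4.1
run with arbitrary coefficients, val-lit-p7 g3's sparse-point proof): if `permSum c ∈
T̂_{[det_n]}𝒟ual_{2n−2,n,n²}` (`n ≥ 3`) then for every `σ` and pairwise distinct `a, c, k, m`,
`c(σ) + c(σ(ac)) + c(σ(km)) + c(σ(ac)(km)) = 0`. Proof: at `(w_{σ,k,m}, X_{σ,a,c})` LMR Lemma 3.3.2
gives `Xᵀ H_π X = c_{X,w} π(w)` on `T̂`, the orbit vector `x_{kσ(k)}∂_{(m,σm)}det_n` pins `c_{X,w} = −2`,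
and the two sides for `π = permSum c` are `2(c(σ(ac)) + c(σ(ac)(km)))` and `c(σ) + c(σ(km))`.
[cite: LandsbergManivelRessayre2013, Lemma 3.4.1 (p. 479)] -/
theorem permSum_fourTerm_of_mem_lmrZariskiTangent (hn : 3 ≤ n) (cf : Equiv.Perm (Fin n) → ℂ)
    (hT : permSum cf ∈ lmrZariskiTangent (σ := Fin n × Fin n) (2 * n - 2) n (detPoly (Fin n) ℂ))
    (σ : Equiv.Perm (Fin n)) {a c k m : Fin n} (hac : a ≠ c) (hak : a ≠ k) (ham : a ≠ m)
    (hck : c ≠ k) (hcm : c ≠ m) (hkm : k ≠ m) :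
    cf σ + cf (σ * Equiv.swap a c) + cf (σ * Equiv.swap k m) +
      cf (σ * Equiv.swap a c * Equiv.swap k m) = 0 := by
  classical
  obtain ⟨cst, hc⟩ := exists_hessianQuadratic_eq_mul_eval_of_mem_lmrZariskiTangent_detPoly hn
    (fourTermW σ k m) (fourTermX σ a c k m) (rank_fourTermW σ hkm)
    (hessianMatrix_detPoly_fourTermW_mulVec_fourTermX σ (by omega) hac ham hcm hkm)
  -- the orbit tangent vector pins the constant: `c = −2`
  have hπ₁ : X (k, σ k) * pderiv (m, σ m) (detPoly (Fin n) ℂ) ∈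
      lmrZariskiTangent (σ := Fin n × Fin n) (2 * n - 2) n (detPoly (Fin n) ℂ) :=
    glTangent_detPoly_subset_lmrZariskiTangent hn (Submodule.subset_span ⟨(m, σ m), (k, σ k), rfl⟩)
  have hX0 : (fun p : Fin n × Fin n => fourTermX σ a c k m p.1 p.2) (k, σ k) = 0 :=
    fourTermX_apply_k σ hac hak ham hck hcm hkm
  have h1 := hc _ hπ₁
  rw [dotProduct_hessianMatrix_X_mul_mulVec (k, σ k) _ _ _ hX0] at h1
  simp only [fourTermW_apply_k σ hkm, one_mul,
    dotProduct_hessianMatrix_pderiv_detPoly_fourTerm σ hac hak ham hck hcm hkm,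
    eval_fourTermW_orbitVector σ hkm] at h1
  have hsgn : ((Equiv.Perm.sign σ : ℤ) : ℂ) ≠ 0 := by
    rcases Int.units_eq_one_or (Equiv.Perm.sign σ) with h | h <;> simp [h]
  have hcst : cst = -2 := (mul_right_cancel₀ hsgn h1).symm
  have h2 := hc _ hT
  rw [dotProduct_hessianMatrix_permSum_fourTerm σ hac hak ham hck hcm hkm,
    eval_fourTermW_permSum σ hkm, hcst] at h2
  linear_combination h2 / 2

end FourTerm

/-! ### A cocycle lemma on `𝔖_n`: functions with vanishing four-term differences -/

section Cocycle

open Equiv Equiv.Perm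

variable (u : Equiv.Perm (Fin n) → ℂ)

/-- Disjoint transpositions commute. [folklore] -/
private theorem swap_mul_swap_comm_of_ne {a c k m : Fin n} (hak : a ≠ k) (ham : a ≠ m) (hck : c ≠ k)
    (hcm : c ≠ m) : swap a c * swap k m = swap k m * swap a c := by
  have hdisj : Equiv.Perm.Disjoint (swap a c) (swap k m) := fun x => by
    by_cases hxa : x = a
    · subst hxa; exact Or.inr (swap_apply_of_ne_of_ne hak ham)
    by_cases hxc : x = c
    · subst hxc; exact Or.inr (swap_apply_of_ne_of_ne hck hcm)
    · exact Or.inl (swap_apply_of_ne_of_ne hxa hxc)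
  exact hdisj.commute.eq

/-- `(a c)(c d)(a c) = (a d)` for pairwise distinct `a, c, d`. [folklore] -/
private theorem swap_mul_swap_mul_swap_eq {a c d : Fin n} (had : a ≠ d) (hcd : c ≠ d) :
    swap a c * swap c d * swap a c = swap a d := by
  rw [Equiv.swap_comm a c, Equiv.swap_comm c d, swap_mul_swap_mul_swap hcd.symm had.symm]

/-- **Step 1.** If all four-term differences of `u` vanish, then `u σ − u (σ·(a c))` depends only on
`(σ a, σ c)`: the transpositions `(k m)` off `{a, c}` generate the pointwise stabiliser of `{a, c}`.
[folklore] -/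
private theorem diff_eq_diff_of_apply_eq
    (hu : ∀ (σ : Equiv.Perm (Fin n)) (a c k m : Fin n), a ≠ c → a ≠ k → a ≠ m → c ≠ k → c ≠ m →
      k ≠ m → u σ - u (σ * swap a c) - u (σ * swap k m) + u (σ * swap a c * swap k m) = 0)
    {a c : Fin n} (hac : a ≠ c) {σ τ : Equiv.Perm (Fin n)} (ha : σ a = τ a) (hc : σ c = τ c) :
    u σ - u (σ * swap a c) = u τ - u (τ * swap a c) := by
  classical
  set π : Equiv.Perm (Fin n) := σ⁻¹ * τ with hπ
  have hπa : π a = a := by rw [hπ, Perm.mul_apply, ← ha, Perm.inv_eq_iff_eq]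
  have hπc : π c = c := by rw [hπ, Perm.mul_apply, ← hc, Perm.inv_eq_iff_eq]
  have hτ : τ = σ * π := by rw [hπ, mul_inv_cancel_left]
  let p : Fin n → Prop := fun x => x ≠ a ∧ x ≠ c
  have h₁ : ∀ x, p (π x) ↔ p x := by
    intro x
    change (π x ≠ a ∧ π x ≠ c) ↔ (x ≠ a ∧ x ≠ c)
    constructor
    · rintro ⟨h1, h2⟩
      exact ⟨fun h => h1 (by rw [h, hπa]), fun h => h2 (by rw [h, hπc])⟩
    · rintro ⟨h1, h2⟩
      refine ⟨fun h => h1 (π.injective (by rw [h, hπa])), fun h => h2 (π.injective (by rw [h, hπc]))⟩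
  have h₂ : ∀ x, π x ≠ x → p x := by
    intro x hx
    refine ⟨fun h => hx ?_, fun h => hx ?_⟩
    · rw [h, hπa]
    · rw [h, hπc]
  have key : ∀ (g : Equiv.Perm {x // p x}) (ρ : Equiv.Perm (Fin n)),
      u (ρ * ofSubtype g) - u (ρ * ofSubtype g * swap a c) = u ρ - u (ρ * swap a c) := by
    intro g
    induction g using swap_induction_on with
    | one => intro ρ; rw [map_one, mul_one]
    | swap_mul f x y hxy ih =>
      intro ρ
      rw [map_mul, ofSubtype_swap_eq, ← mul_assoc, ih (ρ * swap (x : Fin n) (y : Fin n))]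
      have hxy' : (x : Fin n) ≠ y := fun h => hxy (Subtype.ext h)
      have h4 := hu ρ a c x y hac (Ne.symm x.2.1) (Ne.symm y.2.1) (Ne.symm x.2.2) (Ne.symm y.2.2) hxy'
      rw [mul_assoc ρ (swap a c), swap_mul_swap_comm_of_ne (Ne.symm x.2.1) (Ne.symm y.2.1)
        (Ne.symm x.2.2) (Ne.symm y.2.2), ← mul_assoc] at h4
      linear_combination -h4
  rw [hτ, ← ofSubtype_subtypePerm h₁ h₂]
  exact (key _ σ).symm

/-- A permutation with two prescribed values `a ↦ i`, `c ↦ j`. [folklore] -/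
private def pairRep (a c i j : Fin n) : Equiv.Perm (Fin n) :=
  swap (swap a i c) j * swap a i

/-- `pairRep a c i j a = i` (for `a ≠ c`, `i ≠ j`). [folklore] -/
private theorem pairRep_apply_left {a c i j : Fin n} (hac : a ≠ c) (hij : i ≠ j) : pairRep a c i j a = i := by
  rw [pairRep, Perm.mul_apply, swap_apply_left]
  refine swap_apply_of_ne_of_ne ?_ hij
  intro h
  have : swap a i c = swap a i a := by rw [swap_apply_left]; exact h.symm
  exact hac ((swap a i).injective this).symm

/-- `pairRep a c i j c = j`. [folklore] -/
private theorem pairRep_apply_right (a c i j : Fin n) : pairRep a c i j c = j := by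
  rw [pairRep, Perm.mul_apply, swap_apply_left]

/-- The value-level difference function `G_{ac}(i,j) = u σ − u (σ·(a c))` for any `σ` with
`σ a = i`, `σ c = j` (well defined by `diff_eq_diff_of_apply_eq`). [folklore] -/
private def pairFun (a c i j : Fin n) : ℂ :=
  u (pairRep a c i j) - u (pairRep a c i j * swap a c)

/-- A permutation with three prescribed values. [folklore] -/
private theorem exists_perm_apply_eq₃ {a c d i j l : Fin n} (hac : a ≠ c) (had : a ≠ d) (hcd : c ≠ d)
    (hij : i ≠ j) (hil : i ≠ l) (hjl : j ≠ l) :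
    ∃ σ : Equiv.Perm (Fin n), σ a = i ∧ σ c = j ∧ σ d = l := by
  set σ₀ := pairRep a c i j with hσ₀
  have h0a : σ₀ a = i := pairRep_apply_left hac hij
  have h0c : σ₀ c = j := pairRep_apply_right a c i j
  set d₁ := σ₀.symm l with hd₁
  have hd₁a : d₁ ≠ a := by
    intro h; apply hil; rw [← h0a, ← h, hd₁, Equiv.apply_symm_apply]
  have hd₁c : d₁ ≠ c := by
    intro h; apply hjl; rw [← h0c, ← h, hd₁, Equiv.apply_symm_apply]
  refine ⟨σ₀ * swap d d₁, ?_, ?_, ?_⟩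
  · rw [Perm.mul_apply, swap_apply_of_ne_of_ne had hd₁a.symm, h0a]
  · rw [Perm.mul_apply, swap_apply_of_ne_of_ne hcd hd₁c.symm, h0c]
  · rw [Perm.mul_apply, swap_apply_left, hd₁, Equiv.apply_symm_apply]

/-- A third index. [folklore] -/
private theorem exists_ne_ne (hn : 3 ≤ n) (a c : Fin n) : ∃ d : Fin n, d ≠ a ∧ d ≠ c := by
  classical
  have hcard : 0 < ((Finset.univ.erase a).erase c).card := by
    have h1 : (Finset.univ.erase a).card = n - 1 := by
      rw [Finset.card_erase_of_mem (Finset.mem_univ a), Finset.card_univ, Fintype.card_fin]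
    have h2 := Finset.pred_card_le_card_erase (s := Finset.univ.erase a) (a := c)
    omega
  obtain ⟨d, hd⟩ := Finset.card_pos.mp hcard
  simp only [Finset.mem_erase, Finset.mem_univ, and_true] at hd
  exact ⟨d, hd.2, hd.1⟩

variable {u}

section WithHyp

variable (hu : ∀ (σ : Equiv.Perm (Fin n)) (a c k m : Fin n), a ≠ c → a ≠ k → a ≠ m → c ≠ k → c ≠ m →
  k ≠ m → u σ - u (σ * swap a c) - u (σ * swap k m) + u (σ * swap a c * swap k m) = 0)
include hu

/-- `u σ − u (σ·(a c)) = G_{ac}(σ a, σ c)`. [folklore] -/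
private theorem diff_eq_pairFun {a c : Fin n} (hac : a ≠ c) {σ : Equiv.Perm (Fin n)} {i j : Fin n}
    (ha : σ a = i) (hc : σ c = j) : u σ - u (σ * swap a c) = pairFun u a c i j := by
  have hij : i ≠ j := by rw [← ha, ← hc]; exact σ.injective.ne hac
  exact diff_eq_diff_of_apply_eq u hu hac (by rw [ha, pairRep_apply_left hac hij])
    (by rw [hc, pairRep_apply_right])

/-- Antisymmetry: `G_{ac}(j,i) = −G_{ac}(i,j)`. [folklore] -/
private theorem pairFun_swap {a c : Fin n} (hac : a ≠ c) {i j : Fin n} (hij : i ≠ j) :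
    pairFun u a c j i = -pairFun u a c i j := by
  have h := diff_eq_pairFun hu hac (σ := pairRep a c i j * swap a c) (i := j) (j := i)
    (by rw [Perm.mul_apply, swap_apply_left, pairRep_apply_right])
    (by rw [Perm.mul_apply, swap_apply_right, pairRep_apply_left hac hij])
  rw [← h, pairFun, mul_assoc, Equiv.swap_mul_self, mul_one]
  ring

/-- **Step 2.** The three-position identity: for pairwise distinct positions `a, c, d` and a
permutation with `σ a = i`, `σ c = j`, `σ d = l`, telescoping along `(a c)(c d)(a c) = (a d)` gives
`G_{ad}(i,l) = G_{ac}(i,j) + G_{cd}(i,l) + G_{ac}(j,l)`. [folklore] -/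
private theorem pairFun_three {a c d : Fin n} (hac : a ≠ c) (had : a ≠ d) (hcd : c ≠ d)
    {σ : Equiv.Perm (Fin n)} {i j l : Fin n} (ha : σ a = i) (hc : σ c = j) (hd : σ d = l) :
    pairFun u a d i l = pairFun u a c i j + pairFun u c d i l + pairFun u a c j l := by
  have e1 : u σ - u (σ * swap a d) = pairFun u a d i l := diff_eq_pairFun hu had ha hd
  have e2 : u σ - u (σ * swap a c) = pairFun u a c i j := diff_eq_pairFun hu hac ha hc
  have e3 : u (σ * swap a c) - u (σ * swap a c * swap c d) = pairFun u c d i l :=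
    diff_eq_pairFun hu hcd (by rw [Perm.mul_apply, swap_apply_right, ha])
      (by rw [Perm.mul_apply, swap_apply_of_ne_of_ne had.symm hcd.symm, hd])
  have e4 : u (σ * swap a c * swap c d) - u (σ * swap a c * swap c d * swap a c) =
      pairFun u a c j l :=
    diff_eq_pairFun hu hac
      (by rw [Perm.mul_apply, Perm.mul_apply, swap_apply_of_ne_of_ne hac had, swap_apply_left, hc])
      (by rw [Perm.mul_apply, Perm.mul_apply, swap_apply_left, swap_apply_of_ne_of_ne had.symm hcd.symm,
        hd])
  have hconj : σ * swap a c * swap c d * swap a c = σ * swap a d := by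
    rw [mul_assoc, mul_assoc, ← mul_assoc (swap a c), swap_mul_swap_mul_swap_eq had hcd]
  rw [hconj] at e4
  linear_combination -e1 + e2 + e3 + e4

variable (hn : 3 ≤ n)
include hn

/-- **Middle independence**: `G_{ac}(i,j) + G_{ac}(j,l)` does not depend on `j ∉ {i,l}`. [folklore] -/
private theorem pairFun_add_pairFun_eq {a c : Fin n} (hac : a ≠ c) {i l j j' : Fin n} (hil : i ≠ l)
    (hji : j ≠ i) (hjl : j ≠ l) (hj'i : j' ≠ i) (hj'l : j' ≠ l) :
    pairFun u a c i j + pairFun u a c j l = pairFun u a c i j' + pairFun u a c j' l := by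
  obtain ⟨d, hda, hdc⟩ := exists_ne_ne hn a c
  obtain ⟨σ, ha, hc, hd⟩ := exists_perm_apply_eq₃ hac hda.symm hdc.symm hji.symm hil hjl
  obtain ⟨σ', ha', hc', hd'⟩ := exists_perm_apply_eq₃ hac hda.symm hdc.symm hj'i.symm hil hj'l
  have h1 := pairFun_three hu hac hda.symm hdc.symm ha hc hd
  have h2 := pairFun_three hu hac hda.symm hdc.symm ha' hc' hd'
  linear_combination -h1 + h2

/-- **Four-cycle sums vanish**: `G(i,j) + G(j,l) + G(l,m) + G(m,i) = 0`. [folklore] -/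
private theorem pairFun_cycle₄ {a c : Fin n} (hac : a ≠ c) {i j l m : Fin n} (hij : i ≠ j) (hil : i ≠ l)
    (him : i ≠ m) (hjl : j ≠ l) (hlm : l ≠ m) :
    pairFun u a c i j + pairFun u a c j l + pairFun u a c l m + pairFun u a c m i = 0 := by
  have h1 := pairFun_add_pairFun_eq hu hn hac hil hij.symm hjl him.symm hlm.symm
  have h2 := pairFun_swap hu hac hlm.symm
  have h3 := pairFun_swap hu hac him
  linear_combination h1 + h2 + h3

end WithHyp

section WithHyp4

variable (hu : ∀ (σ : Equiv.Perm (Fin n)) (a c k m : Fin n), a ≠ c → a ≠ k → a ≠ m → c ≠ k → c ≠ m →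
  k ≠ m → u σ - u (σ * swap a c) - u (σ * swap k m) + u (σ * swap a c * swap k m) = 0)
variable (hn : 4 ≤ n)
include hu hn

/-- **Three-cycle sums vanish** (`n ≥ 4`): `2·C₃(i,j,m) = C₄(i,j,l,m) + C₄(i,j,m,l) + C₄(i,l,j,m)`
for a fourth value `l`. [folklore] -/
private theorem pairFun_cycle₃ {a c : Fin n} (hac : a ≠ c) {i j m : Fin n} (hij : i ≠ j) (him : i ≠ m)
    (hjm : j ≠ m) : pairFun u a c i j + pairFun u a c j m + pairFun u a c m i = 0 := by
  classical
  -- a fourth value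
  obtain ⟨l, hli, hlj, hlm⟩ : ∃ l : Fin n, l ≠ i ∧ l ≠ j ∧ l ≠ m := by
    have hcard : 0 < (((Finset.univ.erase i).erase j).erase m).card := by
      have h1 : (Finset.univ.erase i).card = n - 1 := by
        rw [Finset.card_erase_of_mem (Finset.mem_univ i), Finset.card_univ, Fintype.card_fin]
      have h2 := Finset.pred_card_le_card_erase (s := Finset.univ.erase i) (a := j)
      have h3 := Finset.pred_card_le_card_erase (s := (Finset.univ.erase i).erase j) (a := m)
      omega
    obtain ⟨l, hl⟩ := Finset.card_pos.mp hcard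
    simp only [Finset.mem_erase, Finset.mem_univ, and_true] at hl
    exact ⟨l, hl.2.2, hl.2.1, hl.1⟩
  have hn3 : 3 ≤ n := by omega
  have c1 := pairFun_cycle₄ hu hn3 hac hij hli.symm him hlj.symm hlm
  have c2 := pairFun_cycle₄ hu hn3 hac hij him hli.symm hjm hlm.symm
  have c3 := pairFun_cycle₄ hu hn3 hac hli.symm hij him hlj hjm
  have s1 := pairFun_swap hu hac hlj.symm
  have s2 := pairFun_swap hu hac hlm
  have s3 := pairFun_swap hu hac hli
  linear_combination (c1 + c2 + c3 - s1 - s2 - s3) / 2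

/-- **Splitting**: `G_{ac}(i,j) = φ(i) − φ(j)` for some `φ`. [folklore] -/
private theorem exists_pairFun_eq_sub {a c : Fin n} (hac : a ≠ c) :
    ∃ φ : Fin n → ℂ, ∀ i j : Fin n, i ≠ j → pairFun u a c i j = φ i - φ j := by
  classical
  refine ⟨fun x => if x = a then 0 else pairFun u a c x a, fun i j hij => ?_⟩
  dsimp only
  by_cases hi : i = a
  · subst hi
    rw [if_pos rfl, if_neg (Ne.symm hij), pairFun_swap hu hac hij]
    ring
  by_cases hj : j = a
  · subst hj
    rw [if_pos rfl, if_neg hi, sub_zero]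
  rw [if_neg hi, if_neg hj]
  have h3 := pairFun_cycle₃ hu hn hac hij hi hj
  have hs := pairFun_swap hu hac hi
  linear_combination h3 - hs

/-- **The cocycle lemma** (`n ≥ 4`): a function `u : 𝔖_n → ℂ` all of whose four-term differences
`u(σ) − u(σ(ac)) − u(σ(km)) + u(σ(ac)(km))` (`a, c, k, m` pairwise distinct) vanish is of the form
`u(ρ) = Σ_a C_{a,ρ(a)} + κ` — a "first-order" function (a matrix coefficient of the permutation
representation plus a constant). Proof: with `z` fixed, `u(ρ) − u(ρ(az)) = φ_a(ρ a) − φ_a(ρ z)`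
(`exists_pairFun_eq_sub`); put `C_a := φ_a` (`a ≠ z`), `C_z := 0`; then `u − Σ_a C_{a,ρ(a)}` is
invariant under the star transpositions `(a z)`, hence under all transpositions
(`(x y) = (z x)(y z)(z x)`), hence constant. This is the coefficient-vector form of LMR Prop. 3.4.2
(`P_n = {1ⁿ, 21^{n−2}}`: the solutions are the `sgn`-twists of the weight-zero vectors of
`Λⁿ⊗Λⁿ ⊕ S_{21^{n−2}}⊗S_{21^{n−2}}`), reached without characters.
[cite: LandsbergManivelRessayre2013, Proposition 3.4.2 (p. 479)] -/
theorem exists_matrix_of_fourTermDiff :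
    ∃ (C : Fin n → Fin n → ℂ) (κ : ℂ), ∀ ρ : Equiv.Perm (Fin n), u ρ = (∑ a, C a (ρ a)) + κ := by
  classical
  set z : Fin n := ⟨0, by omega⟩ with hz
  have hφ : ∀ a : Fin n, a ≠ z → ∃ φ : Fin n → ℂ, ∀ σ : Equiv.Perm (Fin n),
      u σ - u (σ * swap a z) = φ (σ a) - φ (σ z) := by
    intro a haz
    obtain ⟨φ, hφ⟩ := exists_pairFun_eq_sub hu hn haz
    exact ⟨φ, fun σ => by
      rw [diff_eq_pairFun hu haz (σ := σ) rfl rfl]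
      exact hφ _ _ (σ.injective.ne haz)⟩
  choose φ hφ using hφ
  let C : Fin n → Fin n → ℂ := fun a => if h : a = z then 0 else φ a h
  let F : Equiv.Perm (Fin n) → ℂ := fun ρ => u ρ - ∑ a, C a (ρ a)
  -- invariance under the star transpositions `(a z)`
  have star : ∀ (ρ : Equiv.Perm (Fin n)) (a : Fin n), F (ρ * swap a z) = F ρ := by
    intro ρ a
    by_cases haz : a = z
    · rw [haz, swap_self, ← Perm.one_def, mul_one]
    have hdiff : ∑ b, C b (ρ b) - ∑ b, C b ((ρ * swap a z) b) = φ a haz (ρ a) - φ a haz (ρ z) := by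
      rw [← Finset.sum_sub_distrib]
      rw [Finset.sum_eq_add_of_mem a z (Finset.mem_univ _) (Finset.mem_univ _) haz]
      · have hCz : C z = 0 := by simp [C]
        have hCa : C a = φ a haz := by simp [C, haz]
        simp only [hCz, hCa, Perm.mul_apply, swap_apply_left, swap_apply_right, Pi.zero_apply,
          sub_zero, add_zero]
      · intro b _ hb
        rw [Perm.mul_apply, swap_apply_of_ne_of_ne hb.1 hb.2, sub_self]
    have key := hφ a haz ρ
    simp only [F]
    linear_combination hdiff - key
  -- invariance under all transpositions
  have allswap : ∀ (ρ : Equiv.Perm (Fin n)) (x y : Fin n), x ≠ y → F (ρ * swap x y) = F ρ := by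
    intro ρ x y hxy
    by_cases hxz : x = z
    · rw [hxz, Equiv.swap_comm, star]
    by_cases hyz : y = z
    · rw [hyz, star]
    have hdec : swap x y = swap z x * swap y z * swap z x :=
      (swap_mul_swap_mul_swap (x := y) (y := z) (z := x) hyz (Ne.symm hxy)).symm
    rw [hdec, ← mul_assoc, ← mul_assoc, Equiv.swap_comm z x, star, star, star]
  -- hence constant
  have const : ∀ ρ : Equiv.Perm (Fin n), F ρ = F 1 := by
    intro ρ
    induction ρ using swap_induction_on' with
    | one => rfl
    | mul_swap f x y hxy ih => rw [allswap f x y hxy, ih]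
  refine ⟨C, F 1, fun ρ => ?_⟩
  have := const ρ
  simp only [F] at this
  linear_combination this

end WithHyp4

end Cocycle

/-! ### From the cocycle lemma to `𝔤𝔩(W)·det_n` -/

section Assembly

open Equiv Equiv.Perm

/-- `permSum` is additive. [cite: LandsbergManivelRessayre2013, §3.4 (p. 478)] -/
theorem permSum_add (c c' : Equiv.Perm (Fin n) → ℂ) :
    permSum (fun ρ => c ρ + c' ρ) = permSum c + permSum c' := by
  simp only [permSum, add_smul, Finset.sum_add_distrib]

/-- `permSum` is `ℂ`-homogeneous. [cite: LandsbergManivelRessayre2013, §3.4 (p. 478)] -/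
theorem permSum_smul (a : ℂ) (c : Equiv.Perm (Fin n) → ℂ) :
    permSum (fun ρ => a * c ρ) = a • permSum c := by
  simp only [permSum, Finset.smul_sum, smul_smul]

/-- `permSum` commutes with finite sums of coefficient vectors. [cite: LandsbergManivelRessayre2013, §3.4 (p. 478)] -/
theorem permSum_finset_sum {ι : Type*} (s : Finset ι) (c : ι → Equiv.Perm (Fin n) → ℂ) :
    permSum (fun ρ => ∑ i ∈ s, c i ρ) = ∑ i ∈ s, permSum (c i) := by
  simp only [permSum, Finset.sum_smul]
  rw [Finset.sum_comm]

/-- **`x_{ab} · ∂_{ab} det_n = Σ_{ρ : ρ(a) = b} sgn ρ · x_ρ`** — the weight-zero orbit directions.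
[cite: LandsbergManivelRessayre2013, §3.4 (p. 479)] -/
theorem X_mul_pderiv_detPoly_eq_permSum (a b : Fin n) :
    X (a, b) * pderiv (a, b) (detPoly (Fin n) ℂ) =
      permSum fun ρ => if ρ a = b then ((Equiv.Perm.sign ρ : ℤ) : ℂ) else 0 := by
  classical
  rw [pderiv_detPoly_eq_sum, Finset.mul_sum, permSum]
  refine Finset.sum_congr rfl fun ρ _ => ?_
  by_cases h : ρ a = b
  · rw [if_pos h, if_pos h, smul_eq_C_mul, ← mul_assoc, mul_comm (X (a, b)), mul_assoc, ← h,
      Finset.mul_prod_erase (s := Finset.univ) (f := fun i => (X (i, ρ i) : MvPolynomial (Fin n × Fin n) ℂ))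
        (Finset.mem_univ a)]
  · rw [if_neg h, if_neg h, mul_zero, mul_zero, zero_smul]

/-- `sgn(σ·(a c)) = −sgn σ` in `ℂ`. [folklore] -/
private theorem cast_sign_mul_swap (σ : Equiv.Perm (Fin n)) {a c : Fin n} (hac : a ≠ c) :
    ((Equiv.Perm.sign (σ * swap a c) : ℤ) : ℂ) = -((Equiv.Perm.sign σ : ℤ) : ℂ) := by
  rw [Equiv.Perm.sign_mul, Equiv.Perm.sign_swap hac, mul_neg_one, Units.val_neg, Int.cast_neg]

/-- `sgn(σ)² = 1` in `ℂ`. [folklore] -/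
private theorem cast_sign_mul_self (σ : Equiv.Perm (Fin n)) :
    ((Equiv.Perm.sign σ : ℤ) : ℂ) * ((Equiv.Perm.sign σ : ℤ) : ℂ) = 1 := by
  rw [← Int.cast_mul, ← Units.val_mul, Int.units_mul_self, Units.val_one, Int.cast_one]

/-- **First-order coefficient vectors give orbit directions**: if
`c(ρ) = sgn ρ · (Σ_a C_{a,ρ(a)} + κ)` then `permSum c = Σ_{a,b} C_{ab} · x_{ab}∂_{ab}det_n + κ·det_n
∈ 𝔤𝔩(W)·det_n`. [cite: LandsbergManivelRessayre2013, §3.4 (p. 479)] -/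
theorem permSum_mem_glTangent_detPoly_of_eq (hn : 1 ≤ n) (cf : Equiv.Perm (Fin n) → ℂ)
    (C : Fin n → Fin n → ℂ) (κ : ℂ)
    (hc : ∀ ρ, cf ρ = ((Equiv.Perm.sign ρ : ℤ) : ℂ) * ((∑ a, C a (ρ a)) + κ)) :
    permSum cf ∈ glTangent (detPoly (Fin n) ℂ) := by
  classical
  have hcf : cf = fun ρ => (∑ a, ((Equiv.Perm.sign ρ : ℤ) : ℂ) * C a (ρ a)) +
      κ * ((Equiv.Perm.sign ρ : ℤ) : ℂ) := by
    funext ρ; rw [hc, mul_add, Finset.mul_sum]; ring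
  have hrow : ∀ a : Fin n, permSum (fun ρ => ((Equiv.Perm.sign ρ : ℤ) : ℂ) * C a (ρ a)) =
      ∑ b, C a b • (X (a, b) * pderiv (a, b) (detPoly (Fin n) ℂ)) := by
    intro a
    simp_rw [X_mul_pderiv_detPoly_eq_permSum, ← permSum_smul, ← permSum_finset_sum]
    congr 1
    funext ρ
    simp_rw [mul_ite, mul_zero]
    rw [Finset.sum_ite_eq Finset.univ (ρ a), if_pos (Finset.mem_univ _), mul_comm]
  rw [hcf, permSum_add, permSum_finset_sum, permSum_smul, ← detPoly_eq_permSum]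
  refine Submodule.add_mem _ (Submodule.sum_mem _ fun a _ => ?_)
    (Submodule.smul_mem _ _ (detPoly_mem_glTangent hn))
  rw [hrow]
  exact Submodule.sum_mem _ fun b _ =>
    Submodule.smul_mem _ _ (Submodule.subset_span ⟨(a, b), (a, b), rfl⟩)

/-- **Weight zero, `n ≥ 4`**: a coefficient vector with all four-term sums zero gives an element of
`𝔤𝔩(W)·det_n` (cocycle lemma applied to `u = sgn·c`). [cite: LandsbergManivelRessayre2013, §3.4 (p. 479)] -/
theorem permSum_mem_glTangent_detPoly_of_fourTerm (hn : 4 ≤ n) (cf : Equiv.Perm (Fin n) → ℂ)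
    (h4 : ∀ (σ : Equiv.Perm (Fin n)) (a c k m : Fin n), a ≠ c → a ≠ k → a ≠ m → c ≠ k → c ≠ m →
      k ≠ m → cf σ + cf (σ * swap a c) + cf (σ * swap k m) + cf (σ * swap a c * swap k m) = 0) :
    permSum cf ∈ glTangent (detPoly (Fin n) ℂ) := by
  set u : Equiv.Perm (Fin n) → ℂ := fun ρ => ((Equiv.Perm.sign ρ : ℤ) : ℂ) * cf ρ with hu_def
  have hu : ∀ (σ : Equiv.Perm (Fin n)) (a c k m : Fin n), a ≠ c → a ≠ k → a ≠ m → c ≠ k → c ≠ m →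
      k ≠ m → u σ - u (σ * swap a c) - u (σ * swap k m) + u (σ * swap a c * swap k m) = 0 := by
    intro σ a c k m hac hak ham hck hcm hkm
    have h := h4 σ a c k m hac hak ham hck hcm hkm
    simp only [hu_def, cast_sign_mul_swap _ hkm, cast_sign_mul_swap _ hac, neg_neg]
    linear_combination ((Equiv.Perm.sign σ : ℤ) : ℂ) * h
  obtain ⟨C, κ, hCκ⟩ := exists_matrix_of_fourTermDiff hu hn
  refine permSum_mem_glTangent_detPoly_of_eq (by omega) cf C κ fun ρ => ?_
  rw [← hCκ ρ, hu_def, ← mul_assoc, cast_sign_mul_self, one_mul]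

end Assembly

/-! ### The case `n = 3` -/

section Three

open Equiv Equiv.Perm

/-- In `𝔖₃`, the permutations agreeing with `σ` at `a` are `σ` and `σ·(k m)` (`{a,k,m} = [3]`).
[folklore] -/
private theorem perm_fin_three_eq_or_of_apply_eq {a k m : Fin 3} (hak : a ≠ k) (ham : a ≠ m) (hkm : k ≠ m)
    {σ ρ : Equiv.Perm (Fin 3)} (h : ρ a = σ a) : ρ = σ ∨ ρ = σ * swap k m := by
  classical
  have huniv : ({a, k, m} : Finset (Fin 3)) = Finset.univ := by
    apply Finset.eq_univ_of_card
    rw [Finset.card_insert_of_notMem (by simp [hak, ham]), Finset.card_insert_of_notMem (by simp [hkm]),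
      Finset.card_singleton, Fintype.card_fin]
  have hx : ∀ x : Fin 3, x = a ∨ x = k ∨ x = m := by
    intro x
    have := Finset.mem_univ x
    rw [← huniv] at this
    simpa using this
  set π : Equiv.Perm (Fin 3) := σ⁻¹ * ρ with hπ
  have hρ : ρ = σ * π := by rw [hπ, mul_inv_cancel_left]
  have hπa : π a = a := by rw [hπ, Perm.mul_apply, h, Perm.inv_eq_iff_eq]
  have hπk : π k ≠ a := fun h' => hak (π.injective (hπa.trans h'.symm))
  rcases hx (π k) with h1 | h1 | h1
  · exact absurd h1 hπk
  · -- `π k = k`, hence `π m = m` and `π = 1`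
    left
    have hπm : π m = m := by
      rcases hx (π m) with h2 | h2 | h2
      · exact absurd (π.injective (h2.trans hπa.symm)) ham.symm
      · exact absurd (π.injective (h2.trans h1.symm)) hkm.symm
      · exact h2
    have : π = 1 := by
      ext x
      rcases hx x with rfl | rfl | rfl
      · rw [hπa, Perm.one_apply]
      · rw [h1, Perm.one_apply]
      · rw [hπm, Perm.one_apply]
    rw [hρ, this, mul_one]
  · -- `π k = m`, hence `π m = k` and `π = (k m)`
    right
    have hπm : π m = k := by
      rcases hx (π m) with h2 | h2 | h2
      · exact absurd (π.injective (h2.trans hπa.symm)) ham.symm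
      · exact h2
      · exact absurd (π.injective (h2.trans h1.symm)) hkm.symm
    have : π = swap k m := by
      ext x
      rcases hx x with rfl | rfl | rfl
      · rw [hπa, swap_apply_of_ne_of_ne hak ham]
      · rw [h1, swap_apply_left]
      · rw [hπm, swap_apply_right]
    rw [hρ, this]

/-- For `n = 3`: `x_σ − x_{σ(km)} ∈ 𝔤𝔩(W)·det₃` — it is `sgn σ · x_{aσ(a)}∂_{(a,σ a)}det₃` for the third
index `a`. [cite: LandsbergManivelRessayre2013, §3.4 (p. 479)] -/
theorem prod_X_sub_prod_X_swap_mem_glTangent_three (σ : Equiv.Perm (Fin 3)) {k m : Fin 3}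
    (hkm : k ≠ m) :
    (∏ i, X (i, σ i) : MvPolynomial (Fin 3 × Fin 3) ℂ) - ∏ i, X (i, (σ * swap k m) i) ∈
      glTangent (detPoly (Fin 3) ℂ) := by
  classical
  obtain ⟨a, hak, ham⟩ := exists_ne_ne (le_refl 3) k m
  have hne : σ ≠ σ * swap k m := by
    intro h'
    have := congrArg (· k) h'
    simp only [Perm.mul_apply, swap_apply_left] at this
    exact hkm (σ.injective this)
  have hgen : X (a, σ a) * pderiv (a, σ a) (detPoly (Fin 3) ℂ) =
      ((Equiv.Perm.sign σ : ℤ) : ℂ) • ((∏ i, X (i, σ i) : MvPolynomial (Fin 3 × Fin 3) ℂ) -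
        ∏ i, X (i, (σ * swap k m) i)) := by
    rw [X_mul_pderiv_detPoly_eq_permSum, permSum,
      Finset.sum_eq_add_of_mem σ (σ * swap k m) (Finset.mem_univ _) (Finset.mem_univ _) hne]
    · rw [if_pos rfl, if_pos (by rw [Perm.mul_apply, swap_apply_of_ne_of_ne hak ham]),
        cast_sign_mul_swap σ hkm, smul_sub, neg_smul, sub_eq_add_neg]
    · intro ρ _ hρ
      rw [if_neg, zero_smul]
      intro h'
      rcases perm_fin_three_eq_or_of_apply_eq hak ham hkm h' with h'' | h''
      · exact hρ.1 h''
      · exact hρ.2 h''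
  have hmem : X (a, σ a) * pderiv (a, σ a) (detPoly (Fin 3) ℂ) ∈ glTangent (detPoly (Fin 3) ℂ) :=
    Submodule.subset_span ⟨(a, σ a), (a, σ a), rfl⟩
  rw [hgen] at hmem
  have := Submodule.smul_mem _ ((Equiv.Perm.sign σ : ℤ) : ℂ) hmem
  rwa [smul_smul, cast_sign_mul_self, one_smul] at this

/-- For `n = 3`: `x_ρ − x_1 ∈ 𝔤𝔩(W)·det₃` for every `ρ`. [cite: LandsbergManivelRessayre2013, §3.4 (p. 479)] -/
theorem prod_X_sub_prod_X_one_mem_glTangent_three (ρ : Equiv.Perm (Fin 3)) :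
    (∏ i, X (i, ρ i) : MvPolynomial (Fin 3 × Fin 3) ℂ) - ∏ i, X (i, (1 : Equiv.Perm (Fin 3)) i) ∈
      glTangent (detPoly (Fin 3) ℂ) := by
  induction ρ using swap_induction_on' with
  | one => rw [sub_self]; exact Submodule.zero_mem _
  | mul_swap f x y hxy ih =>
    have h := prod_X_sub_prod_X_swap_mem_glTangent_three f hxy
    have := Submodule.sub_mem _ ih h
    convert this using 1
    ring

/-- For `n = 3`: a weight-zero form with coefficient sum zero lies in `𝔤𝔩(W)·det₃`.
[cite: LandsbergManivelRessayre2013, §3.4 (p. 479)] -/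
theorem permSum_mem_glTangent_three_of_sum_eq_zero (cf : Equiv.Perm (Fin 3) → ℂ)
    (h0 : ∑ ρ, cf ρ = 0) : permSum cf ∈ glTangent (detPoly (Fin 3) ℂ) := by
  have hrw : permSum cf = ∑ ρ : Equiv.Perm (Fin 3),
      cf ρ • ((∏ i, X (i, ρ i) : MvPolynomial (Fin 3 × Fin 3) ℂ) -
        ∏ i, X (i, (1 : Equiv.Perm (Fin 3)) i)) := by
    simp only [permSum, smul_sub, Finset.sum_sub_distrib, ← Finset.sum_smul, h0, zero_smul, sub_zero]
  rw [hrw]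
  exact Submodule.sum_mem _ fun ρ _ =>
    Submodule.smul_mem _ _ (prod_X_sub_prod_X_one_mem_glTangent_three ρ)

/-- **Weight zero, `n = 3`** (where four distinct indices do not exist): `𝔤𝔩(W)·det₃` contains every
weight-zero form with coefficient sum zero, a hyperplane of the weight-zero space; `per₃ = permSum 1`
is not tangent (`perPoly_not_mem_lmrZariskiTangent`, val-lit-p8's certificate at `n = 3`), so the
tangent weight-zero forms are exactly that hyperplane. [cite: LandsbergManivelRessayre2013, Proposition 3.4.2 (p. 479)] -/
theorem permSum_mem_glTangent_three_of_mem_lmrZariskiTangent (cf : Equiv.Perm (Fin 3) → ℂ)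
    (hT : permSum cf ∈ lmrZariskiTangent (σ := Fin 3 × Fin 3) (2 * 3 - 2) 3 (detPoly (Fin 3) ℂ)) :
    permSum cf ∈ glTangent (detPoly (Fin 3) ℂ) := by
  classical
  set s : ℂ := ∑ ρ, cf ρ with hs_def
  by_cases hs : s = 0
  · exact permSum_mem_glTangent_three_of_sum_eq_zero cf hs
  exfalso
  have hcard : (Finset.univ : Finset (Equiv.Perm (Fin 3))).card = 6 := by
    rw [Finset.card_univ, Fintype.card_perm, Fintype.card_fin]; rfl
  -- `per₃ = permSum (1 − (6/s)·c) + (6/s) • permSum c`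
  have h0 : ∑ ρ : Equiv.Perm (Fin 3), ((1 : ℂ) - 6 / s * cf ρ) = 0 := by
    rw [Finset.sum_sub_distrib, Finset.sum_const, hcard, ← Finset.mul_sum, ← hs_def]
    field_simp
    ring
  have hmem₁ : permSum (fun ρ => (1 : ℂ) - 6 / s * cf ρ) ∈
      lmrZariskiTangent (σ := Fin 3 × Fin 3) (2 * 3 - 2) 3 (detPoly (Fin 3) ℂ) :=
    glTangent_detPoly_subset_lmrZariskiTangent (le_refl 3)
      (permSum_mem_glTangent_three_of_sum_eq_zero _ h0)
  have hper : perPoly (Fin 3) ℂ = (1 : ℂ) • permSum (fun ρ => (1 : ℂ) - 6 / s * cf ρ) +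
      (6 / s) • permSum cf := by
    rw [perPoly_eq_permSum, one_smul, ← permSum_smul, ← permSum_add]
    congr 1
    funext ρ
    ring
  have := smul_add_smul_mem_lmrZariskiTangent hmem₁ hT 1 (6 / s)
  rw [← hper] at this
  exact perPoly_not_mem_lmrZariskiTangent (le_refl 3) this

end Three

/-! ### The weight-zero isotypic step, all `n ≥ 3` -/

section Main

/-- **LMR 2013 Thm. 3.1.1, isotypic step at weight zero** (`n ≥ 3`): every Zariski tangent vector of
`𝒟ual_{2n−2,n,n²}` at `det_n` lying in the span of the permutation monomials belongs to the orbit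
tangent space `𝔤𝔩(W)·det_n`. LMR obtain this from Prop. 3.4.2 and the multiplicity-free
`GL(E)×GL(F)`-decomposition of `Sⁿ(E⊗F)`; here: four-term relations with arbitrary coefficients
(`permSum_fourTerm_of_mem_lmrZariskiTangent`) + the cocycle lemma (`exists_matrix_of_fourTermDiff`)
for `n ≥ 4`, and the `per₃` argument for `n = 3`.
[cite: LandsbergManivelRessayre2013, Theorem 3.1.1 (p. 476, proof p. 480)] -/
theorem permSum_mem_glTangent_detPoly_of_mem_lmrZariskiTangent (hn : 3 ≤ n)
    (cf : Equiv.Perm (Fin n) → ℂ)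
    (hT : permSum cf ∈ lmrZariskiTangent (σ := Fin n × Fin n) (2 * n - 2) n (detPoly (Fin n) ℂ)) :
    permSum cf ∈ glTangent (detPoly (Fin n) ℂ) := by
  rcases Nat.lt_or_ge n 4 with h | h
  · obtain rfl : n = 3 := by omega
    exact permSum_mem_glTangent_three_of_mem_lmrZariskiTangent cf hT
  · exact permSum_mem_glTangent_detPoly_of_fourTerm h cf fun σ a c k m hac hak ham hck hcm hkm =>
      permSum_fourTerm_of_mem_lmrZariskiTangent hn cf hT σ hac hak ham hck hcm hkm

/-- The same in span form: `T̂_{[det_n]}𝒟ual_{2n−2,n,n²} ∩ span{∏ᵢ x_{iρ(i)}} ⊆ 𝔤𝔩(W)·det_n`.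
[cite: LandsbergManivelRessayre2013, Theorem 3.1.1 (p. 476, proof p. 480)] -/
theorem mem_glTangent_detPoly_of_mem_lmrZariskiTangent_of_mem_span_perm (hn : 3 ≤ n)
    {f : MvPolynomial (Fin n × Fin n) ℂ}
    (hT : f ∈ lmrZariskiTangent (σ := Fin n × Fin n) (2 * n - 2) n (detPoly (Fin n) ℂ))
    (hf : f ∈ Submodule.span ℂ (Set.range fun ρ : Equiv.Perm (Fin n) =>
      ∏ i : Fin n, (X (i, ρ i) : MvPolynomial (Fin n × Fin n) ℂ))) :
    f ∈ glTangent (detPoly (Fin n) ℂ) := by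
  obtain ⟨cf, rfl⟩ := (Submodule.mem_span_range_iff_exists_fun ℂ).mp hf
  exact permSum_mem_glTangent_detPoly_of_mem_lmrZariskiTangent hn cf hT

end Main

end Literature.Computability.AlgebraicComplexity

end
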